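import Summits.CriticalPhenomena.PercolationContinuityZ3.Theorems.PercNearOneGluingNoHeavyRsw3ClusterMomentSums
import HarnessLib

/-!
# RSW3 lane (P2, gen 22): BCKS CLUSTER MOMENTS, III — THE NUMBER OF MACROSCOPIC CLUSTERS IS TIGHT UNDER (A2)□:
# `E_{p_c} N_ε(Λ_N)^t ≤ C_t ε^{−2t}` for every `t`, `N ≥ 1`, `ε > 0`, and `P_{p_c}(N_ε(Λ_N) = 0) → 0` as `ε → 0` uniformly in `N`

builds on p205010 (kernel theorem, internal audit signed; external expert review pending) — NOT used in this file.

Cell `prim-rsw3`, prover seat `prim-rsw3-p2` (gen 22), memo `run/shared/lean/prim/rsw3/P2-RSWLITE.md` §29.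
Support file (`--supports stmt-CriticalPhenomena-4575`); no definitions, no named facts, no sorries.

`N_a(Λ_N)(ω)` = the number of open clusters `C` of `ω` with `|C ∩ Λ(N)| ≥ a`, written INLINE as the number of distinct traces
`#{ C(x) ∩ Λ(N) : x ∈ Λ(N), V_x ≥ a }` (`V_x = |C(x) ∩ Λ(N)| = #{w ∈ Λ(N) : x ↔ w}`); the macroscopic threshold is `a = ε s(N)`,
`s(N) = (2N+1)^d π_{p_c}(N) ≍ E|C_max(Λ_N)|` (gen 21).  Borgs–Chayes–Kesten–Spencer (CMP 2001; Thm. 2 of Chayes' ICM 1998 report: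
`E N_{Λ_n}(s(m), s(km)) ≍ (n/m)^d`) prove the tightness of the number of clusters of each scale under their Scaling Axioms
(verified in `d = 2`).  Here, at `p_c(ℤ^d)` from (A2)□ alone, every `d ≥ 2`:

* §1 (pointwise) `card_image_cluster_mul_le_card_filter` (`a · N_a ≤ #{x : V_x ≥ a}`: the fibre of the trace map over a fat trace `K`
  contains `K` itself), `card_filter_fat_mul_le_pairCount` (`a · #{x : V_x ≥ a} ≤ T_N`), **`sq_mul_card_image_cluster_le_pairCount`**
  (`a² N_a ≤ T_N = Σ_C |C ∩ Λ_N|²`), `card_image_cluster_eq_zero_iff` (`N_a = 0 ↔ M_N < a`), `card_image_cluster_eq_sum_inv`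
  (the cluster-number formula `N_a = Σ_{x : V_x ≥ a} 1/V_x`, hence measurability);
* §2 **`exists_integral_numFat_pow_le_of_setToSetQuasiMultAspectAt`**: `∀ t ∃ C ∀ N ≥ 1 ∀ ε > 0: E_{p_c} N_{εs(N)}^{t+1} ≤ C ε^{−2(t+1)}`
  (part II's moments of `T_N`); the mean `E N_{εs(N)} ≤ C ε^{−2}`; Markov: `P_{p_c}(k ≤ N_{εs(N)}) ≤ C_t ε^{−2t−2}/k^{t+1}`;
* §3 **`exists_real_numFat_eq_zero_le_of_setToSetQuasiMultAspectAt`**: `∀ δ ∃ ε > 0 ∃ N₀ ∀ N ≥ N₀: P_{p_c}(N_{εs(N)} = 0) ≤ δ` (gen 19's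
  lower tightness of `|C_max|`) — together: the number of clusters of `Λ_N` of the size of the largest one is bounded above in every
  moment and below in probability, uniformly in `N` (BCKS's 'the incipient infinite cluster is not unique, but there are only `O(1)`
  of them' in `d` dimensions under (A2)□);
* §4 `…_Z2` — `ℤ²` at `p_c = 1/2`, unconditionally.

References: C. Borgs, J. T. Chayes, H. Kesten, J. Spencer, Comm. Math. Phys. 224 (2001) 153–204, Thm. 1.1; J. T. Chayes, Doc. Math.
Extra Vol. ICM 1998 III, 113–122, Thm. 2 [BorgsChayesKestenSpencer2001]; Random Structures Algorithms 15 (1999) 368–413, §1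
[BorgsChayesKestenSpencer1999]; D. Basu, A. Sapozhnikov, ECP 22 (2017) §1 (A2) [BasuSapozhnikov2017ECP]. [folklore]
-/

noncomputable section

namespace Summit.CriticalPhenomena.PercolationContinuityZ3.Theorems

namespace Rsw3

open MeasureTheory Literature.Probability.LatticeModels Literature.Probability.Percolation
open SurfaceTension Crossing SimpleGraph Finset

variable {d : ℕ}

/-! ## §1 Pointwise: `a² · N_a ≤ T_N` and `N_a = 0 ↔ M_N < a` -/

open Classical in
/-- Sites of one cluster have the same trace: `w ∈ C(x) ⇒ C(w) ∩ Λ(N) = C(x) ∩ Λ(N)`. [folklore] -/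
theorem filter_openConn_eq_of_mem {N : ℕ} {ω : BondConfig (Site d)} {x w : Site d}
    (hw : ω ∈ (openConn x w : Set (BondConfig (Site d)))) :
    ((box d N).filter fun u => ω ∈ (openConn w u : Set (BondConfig (Site d)))) =
      (box d N).filter fun u => ω ∈ (openConn x u : Set (BondConfig (Site d))) := by
  have hxw : (openGraph ω).Reachable x w := hw
  refine Finset.filter_congr fun u _ => ?_
  exact ⟨fun hwu => hxw.trans hwu, fun hxu => hxw.symm.trans hxu⟩

open Classical in
/-- **`a · N_a ≤ #{x ∈ Λ(N) : V_x ≥ a}`**: the trace map `x ↦ C(x) ∩ Λ(N)` on the fat sites has, over each of its `N_a` values `K`, a fibre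
containing `K` itself (`|K| ≥ a` sites, all fat with the same trace). [folklore] -/
theorem card_image_cluster_mul_le_card_filter (N : ℕ) (a : ℝ) (ω : BondConfig (Site d)) :
    a * ((((box d N).filter fun x => a ≤ ((((box d N).filter fun w =>
        ω ∈ (openConn x w : Set (BondConfig (Site d)))).card : ℕ) : ℝ)).image fun x =>
          (box d N).filter fun w => ω ∈ (openConn x w : Set (BondConfig (Site d)))).card : ℝ) ≤
      (((box d N).filter fun x => a ≤ ((((box d N).filter fun w =>
        ω ∈ (openConn x w : Set (BondConfig (Site d)))).card : ℕ) : ℝ)).card : ℝ) := by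
  classical
  set clus : Site d → Finset (Site d) := fun x => (box d N).filter fun w => ω ∈ (openConn x w : Set (BondConfig (Site d)))
    with hclus
  set F := (box d N).filter fun x => a ≤ ((clus x).card : ℝ) with hF
  -- `#F = Σ_{K ∈ F.image clus} #(fibre K)`
  have hfib : F.card = ∑ K ∈ F.image clus, (F.filter fun x => clus x = K).card :=
    Finset.card_eq_sum_card_fiberwise fun x hx => Finset.mem_image_of_mem clus hx
  -- each fibre contains its trace: `K ⊆ fibre K`, and `a ≤ |K|`
  have hK : ∀ K ∈ F.image clus, a ≤ ((F.filter fun x => clus x = K).card : ℝ) := by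
    intro K hK
    obtain ⟨x, hx, rfl⟩ := Finset.mem_image.1 hK
    have hxa : a ≤ ((clus x).card : ℝ) := (Finset.mem_filter.1 hx).2
    refine hxa.trans ?_
    exact_mod_cast Finset.card_le_card fun w hw => by
      have hw' := Finset.mem_filter.1 hw
      have heq : clus w = clus x := by simp only [hclus]; exact filter_openConn_eq_of_mem hw'.2
      refine Finset.mem_filter.2 ⟨Finset.mem_filter.2 ⟨hw'.1, ?_⟩, heq⟩
      rw [heq]; exact hxa
  calc a * ((F.image clus).card : ℝ) = ∑ K ∈ F.image clus, a := by rw [Finset.sum_const, nsmul_eq_mul, mul_comm]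
    _ ≤ ∑ K ∈ F.image clus, ((F.filter fun x => clus x = K).card : ℝ) := Finset.sum_le_sum hK
    _ = (F.card : ℝ) := by rw [hfib]; push_cast; rfl

open Classical in
/-- **`a · #{x ∈ Λ(N) : V_x ≥ a} ≤ T_N`**: sum `a ≤ V_x` over the fat sites and `T_N = Σ_x V_x ≥ Σ_{fat} V_x`. [folklore] -/
theorem card_filter_fat_mul_le_pairCount (N : ℕ) (a : ℝ) (ω : BondConfig (Site d)) :
    a * (((box d N).filter fun x => a ≤ ((((box d N).filter fun w =>
        ω ∈ (openConn x w : Set (BondConfig (Site d)))).card : ℕ) : ℝ)).card : ℝ) ≤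
      (((box d N ×ˢ box d N).filter fun xw => ω ∈ (openConn xw.1 xw.2 : Set (BondConfig (Site d)))).card : ℝ) := by
  classical
  rw [card_filter_pairs_eq_sum, mul_comm, ← nsmul_eq_mul, ← Finset.sum_const]
  calc ∑ x ∈ (box d N).filter (fun x => a ≤ ((((box d N).filter fun w =>
          ω ∈ (openConn x w : Set (BondConfig (Site d)))).card : ℕ) : ℝ)), a
      ≤ ∑ x ∈ (box d N).filter (fun x => a ≤ ((((box d N).filter fun w =>
          ω ∈ (openConn x w : Set (BondConfig (Site d)))).card : ℕ) : ℝ)),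
            ((((box d N).filter fun w => ω ∈ (openConn x w : Set (BondConfig (Site d)))).card : ℕ) : ℝ) :=
        Finset.sum_le_sum fun x hx => (Finset.mem_filter.1 hx).2
    _ ≤ _ := Finset.sum_le_sum_of_subset_of_nonneg (Finset.filter_subset _ _) fun x _ _ => Nat.cast_nonneg _

open Classical in
/-- **`a² · N_a ≤ T_N = Σ_C |C ∩ Λ(N)|²`** (`a ≥ 0`): the number of clusters with at least `a` sites in `Λ(N)` against the size-biased
cluster sum. [cite: BorgsChayesKestenSpencer2001, Thm. 1.1] -/
theorem sq_mul_card_image_cluster_le_pairCount (N : ℕ) {a : ℝ} (ha : 0 ≤ a) (ω : BondConfig (Site d)) :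
    a ^ 2 * ((((box d N).filter fun x => a ≤ ((((box d N).filter fun w =>
        ω ∈ (openConn x w : Set (BondConfig (Site d)))).card : ℕ) : ℝ)).image fun x =>
          (box d N).filter fun w => ω ∈ (openConn x w : Set (BondConfig (Site d)))).card : ℝ) ≤
      (((box d N ×ˢ box d N).filter fun xw => ω ∈ (openConn xw.1 xw.2 : Set (BondConfig (Site d)))).card : ℝ) := by
  calc a ^ 2 * ((((box d N).filter fun x => a ≤ ((((box d N).filter fun w =>
        ω ∈ (openConn x w : Set (BondConfig (Site d)))).card : ℕ) : ℝ)).image fun x =>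
          (box d N).filter fun w => ω ∈ (openConn x w : Set (BondConfig (Site d)))).card : ℝ)
      = a * (a * ((((box d N).filter fun x => a ≤ ((((box d N).filter fun w =>
        ω ∈ (openConn x w : Set (BondConfig (Site d)))).card : ℕ) : ℝ)).image fun x =>
          (box d N).filter fun w => ω ∈ (openConn x w : Set (BondConfig (Site d)))).card : ℝ)) := by ring
    _ ≤ a * (((box d N).filter fun x => a ≤ ((((box d N).filter fun w =>
        ω ∈ (openConn x w : Set (BondConfig (Site d)))).card : ℕ) : ℝ)).card : ℝ) :=
        mul_le_mul_of_nonneg_left (card_image_cluster_mul_le_card_filter N a ω) ha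
    _ ≤ _ := card_filter_fat_mul_le_pairCount N a ω

open Classical in
/-- **`N_a = 0 ↔ M_N < a`**: no cluster has `a` sites in `Λ(N)` iff the largest cluster count is `< a`. [folklore] -/
theorem card_image_cluster_eq_zero_iff (N : ℕ) (a : ℝ) (ω : BondConfig (Site d)) :
    (((box d N).filter fun x => a ≤ ((((box d N).filter fun w =>
        ω ∈ (openConn x w : Set (BondConfig (Site d)))).card : ℕ) : ℝ)).image fun x =>
          (box d N).filter fun w => ω ∈ (openConn x w : Set (BondConfig (Site d)))).card = 0 ↔
      (((box d N).sup fun y => ((box d N).filter fun w =>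
        ω ∈ (openConn y w : Set (BondConfig (Site d)))).card : ℕ) : ℝ) < a := by
  classical
  rw [Finset.card_eq_zero, Finset.image_eq_empty, Finset.filter_eq_empty_iff]
  set vol : Site d → ℕ := fun y => ((box d N).filter fun w => ω ∈ (openConn y w : Set (BondConfig (Site d)))).card with hvol
  have hne : (box d N).Nonempty := ⟨0, zero_mem_box d N⟩
  obtain ⟨x₀, hx₀, hsup⟩ := Finset.exists_mem_eq_sup (box d N) hne vol
  constructor
  · intro h
    rw [hsup]
    exact not_le.1 (h hx₀)
  · intro h x hx hle
    have hx' : ((vol x : ℕ) : ℝ) ≤ (((box d N).sup vol : ℕ) : ℝ) := by exact_mod_cast Finset.le_sup (f := vol) hx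
    exact absurd (hle.trans hx') (not_le.2 h)

/-! ## §2 All moments of the number of macroscopic clusters under (A2)□ -/

open Classical in
/-- **The cluster-number formula `N_a = Σ_{x ∈ Λ(N), V_x ≥ a} 1/V_x`** (`a > 0`): each of the `N_a` fat traces `K` is exactly the fibre
of the trace map over `K` and contributes `|K| · (1/|K|) = 1`. [cite: BorgsChayesKestenSpencer2001, Thm. 1.1] -/
theorem card_image_cluster_eq_sum_inv (N : ℕ) {a : ℝ} (ha : 0 < a) (ω : BondConfig (Site d)) :
    ((((box d N).filter fun x => a ≤ ((((box d N).filter fun w =>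
        ω ∈ (openConn x w : Set (BondConfig (Site d)))).card : ℕ) : ℝ)).image fun x =>
          (box d N).filter fun w => ω ∈ (openConn x w : Set (BondConfig (Site d)))).card : ℝ) =
      ∑ x ∈ (box d N).filter (fun x => a ≤ ((((box d N).filter fun w =>
        ω ∈ (openConn x w : Set (BondConfig (Site d)))).card : ℕ) : ℝ)),
          (((((box d N).filter fun w => ω ∈ (openConn x w : Set (BondConfig (Site d)))).card : ℕ) : ℝ))⁻¹ := by
  classical
  set clus : Site d → Finset (Site d) := fun x => (box d N).filter fun w => ω ∈ (openConn x w : Set (BondConfig (Site d)))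
    with hclus
  set F := (box d N).filter fun x => a ≤ ((clus x).card : ℝ) with hF
  -- the fibre of `clus` over a fat trace `K` is `K`
  have hfib : ∀ K ∈ F.image clus, (F.filter fun x => clus x = K) = K := by
    intro K hK
    obtain ⟨x, hx, rfl⟩ := Finset.mem_image.1 hK
    have hxa : a ≤ ((clus x).card : ℝ) := (Finset.mem_filter.1 hx).2
    ext w
    constructor
    · intro hw
      obtain ⟨hwF, hweq⟩ := Finset.mem_filter.1 hw
      rw [← hweq]
      exact Finset.mem_filter.2 ⟨(Finset.mem_filter.1 hwF).1, SimpleGraph.Reachable.refl _⟩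
    · intro hw
      have hw' := Finset.mem_filter.1 hw
      have heq : clus w = clus x := by simp only [hclus]; exact filter_openConn_eq_of_mem hw'.2
      refine Finset.mem_filter.2 ⟨Finset.mem_filter.2 ⟨hw'.1, ?_⟩, heq⟩
      rw [heq]; exact hxa
  rw [← Finset.sum_fiberwise_of_maps_to (g := clus) (t := F.image clus) fun x hx => Finset.mem_image_of_mem clus hx]
  have hone : ∀ K ∈ F.image clus, ∑ x ∈ F.filter (fun x => clus x = K), (((clus x).card : ℕ) : ℝ)⁻¹ = 1 := by
    intro K hK
    have hKpos : (0 : ℝ) < (K.card : ℝ) := by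
      obtain ⟨x, hx, rfl⟩ := Finset.mem_image.1 hK
      exact ha.trans_le (Finset.mem_filter.1 hx).2
    calc ∑ x ∈ F.filter (fun x => clus x = K), (((clus x).card : ℕ) : ℝ)⁻¹
        = ∑ x ∈ F.filter (fun x => clus x = K), ((K.card : ℕ) : ℝ)⁻¹ :=
          Finset.sum_congr rfl fun x hx => by rw [(Finset.mem_filter.1 hx).2]
      _ = 1 := by rw [Finset.sum_const, hfib K hK, nsmul_eq_mul, mul_inv_cancel₀ hKpos.ne']
  rw [Finset.sum_congr rfl hone, Finset.sum_const, nsmul_eq_mul, mul_one]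

open Classical in
/-- The number of fat traces `N_a` (`a > 0`) is a measurable function of the configuration (`N_a = Σ_x 1{a ≤ V_x}/V_x` with the
measurable counts `V_x`). [folklore] -/
theorem measurable_card_image_cluster (N : ℕ) {a : ℝ} (ha : 0 < a) :
    Measurable fun ω : BondConfig (Site d) => ((((box d N).filter fun x => a ≤ ((((box d N).filter fun w =>
        ω ∈ (openConn x w : Set (BondConfig (Site d)))).card : ℕ) : ℝ)).image fun x =>
          (box d N).filter fun w => ω ∈ (openConn x w : Set (BondConfig (Site d)))).card : ℝ) := by
  classical
  have h : (fun ω : BondConfig (Site d) => ((((box d N).filter fun x => a ≤ ((((box d N).filter fun w =>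
        ω ∈ (openConn x w : Set (BondConfig (Site d)))).card : ℕ) : ℝ)).image fun x =>
          (box d N).filter fun w => ω ∈ (openConn x w : Set (BondConfig (Site d)))).card : ℝ)) =
      fun ω => ∑ x ∈ box d N, if a ≤ ((((box d N).filter fun w => ω ∈ (openConn x w : Set (BondConfig (Site d)))).card : ℕ) : ℝ)
        then (((((box d N).filter fun w => ω ∈ (openConn x w : Set (BondConfig (Site d)))).card : ℕ) : ℝ))⁻¹ else 0 := by
    funext ω
    rw [card_image_cluster_eq_sum_inv N ha ω, Finset.sum_filter]
  rw [h]
  refine Finset.measurable_sum _ fun x _ => ?_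
  have hV := measurable_card_filter_openConn_root (d := d) N x
  exact Measurable.ite (measurableSet_le measurable_const hV) hV.inv measurable_const

open Classical in
/-- `0 ≤ N_a ≤ |Λ(N)|`, so every power of `N_a` (`a > 0`) is integrable for a finite measure. [folklore] -/
theorem integrable_card_image_cluster_pow (μ : Measure (BondConfig (Site d))) [IsFiniteMeasure μ] (N t : ℕ) {a : ℝ}
    (ha : 0 < a) :
    Integrable (fun ω : BondConfig (Site d) => ((((box d N).filter fun x => a ≤ ((((box d N).filter fun w =>
        ω ∈ (openConn x w : Set (BondConfig (Site d)))).card : ℕ) : ℝ)).image fun x =>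
          (box d N).filter fun w => ω ∈ (openConn x w : Set (BondConfig (Site d)))).card : ℝ) ^ t) μ := by
  classical
  refine (integrable_const (((box d N).card : ℝ) ^ t)).mono' ((measurable_card_image_cluster N ha).pow_const t).aestronglyMeasurable
    (Filter.Eventually.of_forall fun ω => ?_)
  have h0 : (0 : ℝ) ≤ ((((box d N).filter fun x => a ≤ ((((box d N).filter fun w =>
      ω ∈ (openConn x w : Set (BondConfig (Site d)))).card : ℕ) : ℝ)).image fun x =>
        (box d N).filter fun w => ω ∈ (openConn x w : Set (BondConfig (Site d)))).card : ℝ) := Nat.cast_nonneg _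
  rw [Real.norm_eq_abs, abs_of_nonneg (pow_nonneg h0 t)]
  refine pow_le_pow_left₀ h0 ?_ t
  exact_mod_cast Finset.card_image_le.trans (Finset.card_filter_le _ _)

open Classical in
/-- **ALL MOMENTS OF THE NUMBER OF MACROSCOPIC CLUSTERS UNDER (A2)□** (`p_c(ℤ^d)`, `d ≥ 2`, (A2)□ at `(s,L)`, `2 ≤ s ≤ L`, `ϰ > 0`):
for every `t` there is `C` with, for all `N ≥ 1` and all `ε > 0`,
`E_{p_c} N_{ε s(N)}(Λ_N)^{t+1} ≤ C · ε^{−(2t+2)}`,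
where `N_a(Λ_N)` is the number of open clusters with at least `a` sites in `Λ(N)` and `s(N) = (2N+1)^d π_{p_c}(N)` (`≍ E|C_max(Λ_N)|`):
`(εs)² N_{εs} ≤ T_N` pointwise and `E T_N^{t+1} ≤ C s^{2t+2}` (part II).  The number of clusters of the order of the largest one is
bounded in every moment, uniformly in the volume (BCKS 2001 Thm. 1.1 (ii)/Thm. 2 under the Scaling Axioms; here from (A2)□, every `d`).
[cite: BorgsChayesKestenSpencer2001, Thm. 1.1] [cite: BasuSapozhnikov2017ECP, §1 assumption (A2)] -/
theorem exists_integral_numFat_pow_le_of_setToSetQuasiMultAspectAt (hd : 2 ≤ d) {s L : ℕ} (hs : 2 ≤ s) (hsL : s ≤ L)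
    {ϰ : ℝ} (hϰ : 0 < ϰ) (h : SetToSetQuasiMultAspectAt d (criticalProbI d) s L ϰ) (t : ℕ) :
    ∃ C : ℝ, 0 < C ∧ ∀ (N : ℕ) (ε : ℝ), 1 ≤ N → 0 < ε →
      ∫ ω, ((((box d N).filter fun x =>
          ε * ((2 * (N : ℝ) + 1) ^ d * oneArmProb d (criticalProbI d) N) ≤ ((((box d N).filter fun w =>
            ω ∈ (openConn x w : Set (BondConfig (Site d)))).card : ℕ) : ℝ)).image fun x =>
          (box d N).filter fun w => ω ∈ (openConn x w : Set (BondConfig (Site d)))).card : ℝ) ^ (t + 1)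
        ∂(bondPercolation (zdGraph d) (criticalProbI d)) ≤
      C * (1 / ε) ^ (2 * t + 2) := by
  classical
  have hd1 : 1 ≤ d := by omega
  -- the upper half of part II holds for every `N ≥ 1`
  obtain ⟨A, A', B, hA, hA', hR1, hRlin, hR2, hpc, hπ1⟩ := exists_ratios_of_setToSetQuasiMultAspectAt hd hs hsL hϰ h
  obtain ⟨C₁, hC₁, hup⟩ := exists_integral_pairCount_pow_le hd1 (criticalProbI d) hpc hA hA' hR1 hRlin hR2 hπ1 t
  set μ := bondPercolation (zdGraph d) (criticalProbI d) with hμ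
  refine ⟨C₁, hC₁, fun N ε hN hε => ?_⟩
  have hπpos : 0 < oneArmProb d (criticalProbI d) N :=
    (pow_pos hpc N).trans_le (DKT20.pow_le_real_siteToBoundary hd1 (criticalProbI d) N)
  set sN : ℝ := (2 * (N : ℝ) + 1) ^ d * oneArmProb d (criticalProbI d) N with hsN
  have hs : 0 < sN := mul_pos (by positivity) hπpos
  set a : ℝ := ε * sN with ha
  have ha0 : 0 < a := mul_pos hε hs
  -- pointwise `N_a^{t+1} ≤ (T_N / a²)^{t+1}`
  have hpt : ∀ ω : BondConfig (Site d), ((((box d N).filter fun x => a ≤ ((((box d N).filter fun w =>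
        ω ∈ (openConn x w : Set (BondConfig (Site d)))).card : ℕ) : ℝ)).image fun x =>
          (box d N).filter fun w => ω ∈ (openConn x w : Set (BondConfig (Site d)))).card : ℝ) ^ (t + 1) ≤
      (1 / a ^ 2) ^ (t + 1) * ((((box d N ×ˢ box d N).filter fun xw =>
        ω ∈ (openConn xw.1 xw.2 : Set (BondConfig (Site d)))).card : ℕ) : ℝ) ^ (t + 1) := by
    intro ω
    rw [← mul_pow]
    refine pow_le_pow_left₀ (Nat.cast_nonneg _) ?_ _
    have h1 := sq_mul_card_image_cluster_le_pairCount N ha0.le ω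
    have ha2 : a ^ 2 ≠ 0 := (pow_pos ha0 2).ne'
    calc ((((box d N).filter fun x => a ≤ ((((box d N).filter fun w =>
          ω ∈ (openConn x w : Set (BondConfig (Site d)))).card : ℕ) : ℝ)).image fun x =>
            (box d N).filter fun w => ω ∈ (openConn x w : Set (BondConfig (Site d)))).card : ℝ)
        = 1 / a ^ 2 * (a ^ 2 * ((((box d N).filter fun x => a ≤ ((((box d N).filter fun w =>
          ω ∈ (openConn x w : Set (BondConfig (Site d)))).card : ℕ) : ℝ)).image fun x =>
            (box d N).filter fun w => ω ∈ (openConn x w : Set (BondConfig (Site d)))).card : ℝ)) := by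
          rw [one_div, inv_mul_cancel_left₀ ha2]
      _ ≤ 1 / a ^ 2 * _ := mul_le_mul_of_nonneg_left h1 (one_div_nonneg.2 (pow_nonneg ha0.le 2))
  calc ∫ ω, ((((box d N).filter fun x => a ≤ ((((box d N).filter fun w =>
          ω ∈ (openConn x w : Set (BondConfig (Site d)))).card : ℕ) : ℝ)).image fun x =>
            (box d N).filter fun w => ω ∈ (openConn x w : Set (BondConfig (Site d)))).card : ℝ) ^ (t + 1) ∂μ
      ≤ ∫ ω, (1 / a ^ 2) ^ (t + 1) * ((((box d N ×ˢ box d N).filter fun xw =>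
          ω ∈ (openConn xw.1 xw.2 : Set (BondConfig (Site d)))).card : ℕ) : ℝ) ^ (t + 1) ∂μ :=
        integral_mono_of_nonneg (Filter.Eventually.of_forall fun ω => pow_nonneg (Nat.cast_nonneg _) _)
          ((integrable_card_filter_pairSet_pow μ _ (t + 1)).const_mul _) (Filter.Eventually.of_forall hpt)
    _ = (1 / a ^ 2) ^ (t + 1) * ∫ ω, ((((box d N ×ˢ box d N).filter fun xw =>
          ω ∈ (openConn xw.1 xw.2 : Set (BondConfig (Site d)))).card : ℕ) : ℝ) ^ (t + 1) ∂μ := integral_const_mul _ _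
    _ ≤ (1 / a ^ 2) ^ (t + 1) * (C₁ * sN ^ (2 * t + 2)) :=
        mul_le_mul_of_nonneg_left (hup N hN) (pow_nonneg (one_div_nonneg.2 (pow_nonneg ha0.le 2)) _)
    _ = C₁ * (1 / ε) ^ (2 * t + 2) := by
        have hs' : sN ≠ 0 := hs.ne'
        have hε' : ε ≠ 0 := hε.ne'
        have hpow : (1 / a ^ 2) ^ (t + 1) * sN ^ (2 * t + 2) = (1 / ε) ^ (2 * t + 2) := by
          rw [ha, show 2 * t + 2 = 2 * (t + 1) by ring, pow_mul, pow_mul, ← mul_pow]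
          congr 1
          field_simp
        rw [mul_left_comm, hpow]

open Classical in
/-- **Markov form: super-polynomial tail of the number of macroscopic clusters** — for every `t` there is `C` with, for all `N ≥ 1`,
`ε > 0`, `k > 0`: `P_{p_c}(k ≤ N_{εs(N)}(Λ_N)) ≤ C ε^{−(2t+2)} / k^{t+1}`. [cite: BorgsChayesKestenSpencer2001, Thm. 1.1] -/
theorem exists_real_le_numFat_le_of_setToSetQuasiMultAspectAt (hd : 2 ≤ d) {s L : ℕ} (hs : 2 ≤ s) (hsL : s ≤ L)
    {ϰ : ℝ} (hϰ : 0 < ϰ) (h : SetToSetQuasiMultAspectAt d (criticalProbI d) s L ϰ) (t : ℕ) :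
    ∃ C : ℝ, 0 < C ∧ ∀ (N : ℕ) (ε k : ℝ), 1 ≤ N → 0 < ε → 0 < k →
      (bondPercolation (zdGraph d) (criticalProbI d)).real {ω | k ≤ ((((box d N).filter fun x =>
          ε * ((2 * (N : ℝ) + 1) ^ d * oneArmProb d (criticalProbI d) N) ≤ ((((box d N).filter fun w =>
            ω ∈ (openConn x w : Set (BondConfig (Site d)))).card : ℕ) : ℝ)).image fun x =>
          (box d N).filter fun w => ω ∈ (openConn x w : Set (BondConfig (Site d)))).card : ℝ)} ≤
      C * (1 / ε) ^ (2 * t + 2) / k ^ (t + 1) := by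
  classical
  have hd1 : 1 ≤ d := by omega
  obtain ⟨C, hC, hle⟩ := exists_integral_numFat_pow_le_of_setToSetQuasiMultAspectAt hd hs hsL hϰ h t
  set μ := bondPercolation (zdGraph d) (criticalProbI d) with hμ
  refine ⟨C, hC, fun N ε k hN hε hk => ?_⟩
  set a : ℝ := ε * ((2 * (N : ℝ) + 1) ^ d * oneArmProb d (criticalProbI d) N) with ha
  set X : BondConfig (Site d) → ℝ := fun ω => ((((box d N).filter fun x => a ≤ ((((box d N).filter fun w =>
      ω ∈ (openConn x w : Set (BondConfig (Site d)))).card : ℕ) : ℝ)).image fun x =>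
        (box d N).filter fun w => ω ∈ (openConn x w : Set (BondConfig (Site d)))).card : ℝ) with hX
  have hpc : 0 < ((criticalProbI d : unitInterval) : ℝ) := by rw [coe_criticalProbI]; exact criticalProb_zd_pos d hd1
  have hπpos : 0 < oneArmProb d (criticalProbI d) N :=
    (pow_pos hpc N).trans_le (DKT20.pow_le_real_siteToBoundary hd1 (criticalProbI d) N)
  have ha0 : 0 < a := mul_pos hε (mul_pos (by positivity) hπpos)
  have hint : Integrable (fun ω => X ω ^ (t + 1)) μ := integrable_card_image_cluster_pow μ N (t + 1) ha0
  have hX0 : ∀ ω, 0 ≤ X ω := fun ω => Nat.cast_nonneg _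
  -- Markov: `k^{t+1} P(k ≤ X) ≤ E X^{t+1}`
  have hmarkov := mul_meas_ge_le_integral_of_nonneg (μ := μ) (f := fun ω => X ω ^ (t + 1))
    (Filter.Eventually.of_forall fun ω => pow_nonneg (hX0 ω) _) hint (k ^ (t + 1))
  have hsub : {ω | k ≤ X ω} ⊆ {ω | k ^ (t + 1) ≤ X ω ^ (t + 1)} := fun ω hω => pow_le_pow_left₀ hk.le hω _
  have hkpos : 0 < k ^ (t + 1) := pow_pos hk _
  have h1 : μ.real {ω | k ≤ X ω} ≤ (∫ ω, X ω ^ (t + 1) ∂μ) / k ^ (t + 1) := by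
    rw [le_div_iff₀ hkpos, mul_comm]
    exact (mul_le_mul_of_nonneg_left (measureReal_mono hsub) hkpos.le).trans hmarkov
  calc μ.real {ω | k ≤ X ω} ≤ (∫ ω, X ω ^ (t + 1) ∂μ) / k ^ (t + 1) := h1
    _ ≤ C * (1 / ε) ^ (2 * t + 2) / k ^ (t + 1) := div_le_div_of_nonneg_right (hle N ε hN hε) hkpos.le

/-! ## §3 At least one macroscopic cluster with high probability -/

open Classical in
/-- **AT LEAST ONE MACROSCOPIC CLUSTER, UNIFORMLY IN THE VOLUME** (`p_c(ℤ^d)`, `d ≥ 2`, (A2)□ at one aspect): for every `δ > 0` there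
are `ε > 0` and `N₀` with `P_{p_c}(N_{ε s(N)}(Λ_N) = 0) ≤ δ` for all `N ≥ N₀` (`N_a = 0 ↔ M_N < a` and gen 19's lower tightness of the
largest cluster).  With §2: the number of clusters of `Λ_N` comparable to the largest one is tight in both directions.
[cite: BorgsChayesKestenSpencer2001, Thm. 1.1] [cite: BasuSapozhnikov2017ECP, §1 assumption (A2)] -/
theorem exists_real_numFat_eq_zero_le_of_setToSetQuasiMultAspectAt (hd : 2 ≤ d) {s L : ℕ} (hs : 2 ≤ s) (hsL : s ≤ L)
    {ϰ : ℝ} (hϰ : 0 < ϰ) (h : SetToSetQuasiMultAspectAt d (criticalProbI d) s L ϰ) :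
    ∀ δ : ℝ, 0 < δ → ∃ ε : ℝ, 0 < ε ∧ ∃ N₀ : ℕ, ∀ N : ℕ, N₀ ≤ N →
      (bondPercolation (zdGraph d) (criticalProbI d)).real {ω | (((box d N).filter fun x =>
          ε * ((2 * (N : ℝ) + 1) ^ d * oneArmProb d (criticalProbI d) N) ≤ ((((box d N).filter fun w =>
            ω ∈ (openConn x w : Set (BondConfig (Site d)))).card : ℕ) : ℝ)).image fun x =>
          (box d N).filter fun w => ω ∈ (openConn x w : Set (BondConfig (Site d)))).card = 0} ≤ δ := by
  classical
  intro δ hδ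
  obtain ⟨ε, hε, N₀, hN₀⟩ := exists_real_sup_two_sided_of_setToSetQuasiMultAspectAt hd hs hsL hϰ h δ hδ
  refine ⟨ε, hε, N₀, fun N hN => le_trans (measureReal_mono fun ω hω => ?_) (hN₀ N hN).1⟩
  exact (card_image_cluster_eq_zero_iff N _ ω).1 hω

/-! ## §4 `ℤ²`, unconditionally -/

open Classical in
/-- **`ℤ²` at `p_c = 1/2`, UNCONDITIONALLY**: the number of open clusters with at least `ε (2N+1)² π_{1/2}(N)` sites in `Λ(N)` has
`(t+1)`-st moment `≤ C_t ε^{−(2t+2)}` for all `N ≥ 1`, `ε > 0` (BCKS 2001 in `d = 2`; here via the planar (A2)□ from RSW).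
[cite: BorgsChayesKestenSpencer2001, Thm. 1.1] -/
theorem exists_integral_numFat_pow_le_Z2 (t : ℕ) :
    ∃ C : ℝ, 0 < C ∧ ∀ (N : ℕ) (ε : ℝ), 1 ≤ N → 0 < ε →
      ∫ ω, ((((box 2 N).filter fun x =>
          ε * ((2 * (N : ℝ) + 1) ^ 2 * oneArmProb 2 (criticalProbI 2) N) ≤ ((((box 2 N).filter fun w =>
            ω ∈ (openConn x w : Set (BondConfig (Site 2)))).card : ℕ) : ℝ)).image fun x =>
          (box 2 N).filter fun w => ω ∈ (openConn x w : Set (BondConfig (Site 2)))).card : ℝ) ^ (t + 1)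
        ∂(bondPercolation (zdGraph 2) (criticalProbI 2)) ≤
      C * (1 / ε) ^ (2 * t + 2) := by
  classical
  obtain ⟨ϰ, hϰ, hA2⟩ := exists_setToSetQuasiMultAspectAt_two_of_criticalProbI_le
  exact exists_integral_numFat_pow_le_of_setToSetQuasiMultAspectAt (d := 2) le_rfl (by norm_num) (by norm_num) hϰ
    (hA2 _ le_rfl) t

open Classical in
/-- **`ℤ²` at `p_c = 1/2`, UNCONDITIONALLY**: for every `δ > 0` there are `ε > 0`, `N₀` with
`P_{1/2}(no open cluster has ε (2N+1)² π_{1/2}(N) sites in Λ(N)) ≤ δ` for all `N ≥ N₀`. [cite: BorgsChayesKestenSpencer2001, Thm. 1.1] -/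
theorem exists_real_numFat_eq_zero_le_Z2 :
    ∀ δ : ℝ, 0 < δ → ∃ ε : ℝ, 0 < ε ∧ ∃ N₀ : ℕ, ∀ N : ℕ, N₀ ≤ N →
      (bondPercolation (zdGraph 2) (criticalProbI 2)).real {ω | (((box 2 N).filter fun x =>
          ε * ((2 * (N : ℝ) + 1) ^ 2 * oneArmProb 2 (criticalProbI 2) N) ≤ ((((box 2 N).filter fun w =>
            ω ∈ (openConn x w : Set (BondConfig (Site 2)))).card : ℕ) : ℝ)).image fun x =>
          (box 2 N).filter fun w => ω ∈ (openConn x w : Set (BondConfig (Site 2)))).card = 0} ≤ δ := by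
  classical
  obtain ⟨ϰ, hϰ, hA2⟩ := exists_setToSetQuasiMultAspectAt_two_of_criticalProbI_le
  exact exists_real_numFat_eq_zero_le_of_setToSetQuasiMultAspectAt (d := 2) le_rfl (by norm_num) (by norm_num) hϰ (hA2 _ le_rfl)

end Rsw3

end Summit.CriticalPhenomena.PercolationContinuityZ3.Theorems
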